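import Literature.MathematicalPhysics.QuantumFieldTheory.Balaban1983to89.B12TreeDecay
import Literature.MathematicalPhysics.QuantumFieldTheory.Balaban1983to89.Step

/-!
# `Balaban1983to89.B12Carve18Sect0ThmsHyp` — [B12] Sect. 0 part 2, pp. 257–260 ((0.24)–(0.32), Definition p. 259,
# Theorem 1 p. 259, Theorem 2 (0.31) pp. 259–260) CARVED: the section's printed statements conjoined BY NAME into
# one hypothesis bundle `Hyp` keyed to `stmt-QuantumFields-20543` (also feeds `stmt-QuantumFields-20541`,
# `stmt-QuantumFields-20542`), the two formal clauses of p. 258 that no declaration of the tree states typed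
# hypothesis-form (and proved from the §1 hypotheses of the tree), and the in-tree citation index of the block's
# sixteen SKELETON rows

statement-level skeleton of published theorems with citation tags; proofs where landed; nothing here is a claim about the
Yang–Mills mass gap

CITATION HEADER (lean-in-tree rule).  B12 = [I] = T. Bałaban, *Renormalization group approach to lattice gauge field
theories. I. Generation of effective actions in a small field approximation and a coupling constant renormalization
in four dimensions*, Commun. Math. Phys. **109** (1987) 249–301 [Balaban1987RG1] (doi:10.1007/bf01215223; held
`paper:balaban1987-cmp109-rg-i-small-field`, journal page = PDF page + 248; text layer `pNNNN.txt` of `lit read`; the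
page renders `pub/pub-balaban/b2b-balaban-ref1/pages/1987-cmp109-rg-I-small-field/…-p008-x2.png … -p012-x2.png` of
pp. 256–260 were READ AS IMAGES by this seat, 2026-08-28); [15] = B11 = T. Bałaban, *The variational problem and
background fields in renormalization group method for lattice gauge theories*, Commun. Math. Phys. **102** (1985)
277–309 [Balaban1985Variational]; [II] = B13 = [Balaban1988RG2Cluster].  Cell `lit-balaban`, P6 CARVING FAN
(D-0154 (3b)), BLOCK 18 of `carve/BLOCKS-11-20.md` (lead g30, 2026-08-28T05:30Z): source section = [B12] Sect. 0,
second part, journal pp. 257–260 [PDF 9–12], from «25, 26]. To describe it we have to introduce new geometric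
definitions» (p. 257 line 1, after (0.23)) to the display (0.32) and its two closing sentences (p. 260; Sect. 1 from
«1. The Inductive Description …» on is block 19); KEY item `stmt-QuantumFields-20543` (K2⁷ `EndpointGivenBR13SepCoPH`,
lane [B12]/[B13]); also feeds `stmt-QuantumFields-20541` (K0⁷), `stmt-QuantumFields-20542` (K1⁷).  Seat
`lit-balaban-carve-18` (literature-prover-lit-balaban-carve-18-g0-0).  Rules `carve/CARVE-RULES.md`: in tree =
cite, never restate; hypothesis form; no `instance`, no `notation`; 0 sorry; desk stems of decade 2 (`Node00/*`,
`T3*`, `T4*`, `B11Thm1*`, `B11Leaf*`) and of §2.6 untouched (cited only).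

WHAT THIS FILE IS.  The block is IN TREE at statement level (16 SKELETON rows of v3.370: proved 8, typed-existing 4,
proved-existing 3, absent 1 = the p. 258 road-map `B12.Txt@258`; 14 statement-level declarations with a locator in
pp. 257–260).  Accordingly this file (i) RESTATES NOTHING that has a declaration: every row is cited by name in the
INDEX below, and the rows' HYPOTHESIS-FORM declarations (`B12.Sum024Printed`, `B12.Bound025Printed`,
`B12.Sum023Printed`, `B12.Repr022`, `B12.Sum028Printed`, `B12.Bound029Printed`, `B12.Thm1Printed`,
`B12.Thm2Printed`) are USED, by name, in the bundle `Hyp` and in the two readings `RepresentationAssumedPrinted`,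
`Thm1ReadingPrinted` (§2); the rows realised by PROVED theorems or by definitions with bodies are cited only — a
proved statement is not a hypothesis; (ii) types, hypothesis-form over the tree's small-field tower `Step.SFTower`
(the carrier of the inductive assumptions (1.1)–(1.22), row B12.Def§1), the two formal clauses of the p. 258 road
map (`B12.Txt@258`, «absent») that no declaration states as printed — the vacuum-energy normalisation «𝐄^{(j)}(1) = 0»
(`VacuumNormalized258Printed`, text layer `p0010.txt:L5–L9`) and the gauge reduction to the local chart «By the
gauge invariance we have 𝐄^{(j)}(X, U_k) = 𝐄^{(j)}(X, exp iη𝐇)» (`GaugeReduction258Printed`, `p0010.txt:L22–L27`) —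
and PROVES both readings against the tree (§1: the second IS a consequence of the §1 hypotheses (1.7) + (1.19) as
typed in `Step.SFHyp`; under the first the tree's built-in subtraction in `Step.SFTower.Ek` is inert and 𝐄_k is the
sum (0.23) AS PRINTED, `B12.Sum023Printed`); (iii) defines ONE bundle `Hyp` (§2) = the conjunction, by name, of the
section's printed statements at the level of the family of lattice approximations `B12.Construction` (the consumer
level of K0⁷ ∕ K1⁷ ∕ K2⁷): the standing assumption (0.24)–(0.25) of p. 257, Theorem 1, the printed READING of
Theorem 1's conclusion («given by the formulas (0.22)–(0.24), with terms satisfying (0.29)», through (0.28)), and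
Theorem 2 with (0.31); (iv) kernel-checks (§3) how the bundle delivers the section's DERIVED displays through the
tree's own theorems — (0.26) (`B12.chain026Printed_of`), (0.27) (`B12.bound027_of_025`), (0.29) on the large
domains (`B12.bound029_of_025_large`), and (0.30) = ultraviolet stability «uniform in the lattice spacing ε»
(`B12.uvStable030_of_thm1`, and with the tree-decay input discharged `B12TreeDecay.uvStable030_of_thm1_of_volumeLeaf`)
— the silent inputs of the printed chains (tree-decay summability, cube and site counts) entering BY THE SAME
HYPOTHESIS SHAPES as in `…Balaban1983to89.B12` (nothing printed is proved here that the tree had not proved; the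
value is the wiring of `Hyp` into those theorems).  It moves no node count and proves no summit statement.

INDEX — the sixteen SKELETON rows of block 18 — row id · printed item · page: journal [PDF] (text-layer lines) ·
IN-TREE declarations cited BY NAME (all under `Literature.MathematicalPhysics.QuantumFieldTheory.Balaban1983to89.`;
«used» = conjoined in `Hyp` ∕ the two readings below; «proved» ∕ «def» = a theorem ∕ a definition with body in the
tree, hence not a hypothesis here):
* B12.Def§0 + B12.Note@257 · the cubes π_j of size M = L^m centred at T_M^{(j+m)}, □̃ⁿ, localization domains,
  𝐃_j, the linear size d_j(X), «there are also the shortest tree graphs formed by edges of cubes in X, hence an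
  equivalent definition can be formulated» · p. 257 [9] (`p0009.txt:L2–L29`) · `LocDomainSys` (def, root namespace
  of the cell), `B12.CubeCover` (def), `B12TreeDecay.CubeSystem` (def: «a union of a connected, finite family of
  cubes»), concrete `TreeLength.treeLen`, `TreeLengthTorus`, `B12Cubes436` (□̃ⁿ), `B12EdgeTreeLength257.edgeLen` with
  `edgeLen_le_affine_treeLen` ∕ `treeLen_block_lt_edgeLen_block` and `B12EdgeTreeLength257L1.treeLen1` («equivalent
  definition»: TRUE for the ℓ¹ length, up to constants for the Euclidean ∕ sup length — the tree's recorded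
  reading), `B12ShortestGraph257`, `B12ShortestTreeGraph257.exists_minShortest` (proved ∕ defs; cited only).  The
  sentence «Domains from different classes, i.e. classes corresponding to different indices j, are connected by
  scaling transformations» is the tree's `TreeLengthTorusTransfer` ∕ `T4HistoryLipschitzRescalingTorus` reading
  (cited only; `T4*` is a desk stem).
* B12.Eq0.24 · (0.24) with «where 𝐄^{(j)}(X, U) are analytic and gauge invariant functions of U, depending on U
  restricted to X» · p. 257 [9] (`p0009.txt:L30–L35`) · `B12.Sum024Printed` (used), `LocExpansion` ∕
  `LocExpansion.total` ∕ `LocExpansion.LocalDependence` (defs), the §1 clauses `Step.SFHyp.localDep` (1.7),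
  `Step.SFHyp.gaugeInv119` (1.19) (block 19; analyticity in U is NOT typed on the abstract carrier — DIVERGENCE
  D-f2.1 of `Step`, the holomorphy hypotheses of `B12CauchyRemainder354` ∕ `B12Sect3Closing281` where consumed).
* B12.Eq0.25 · (0.25) «with a sufficiently large constant κ» · p. 257 [9] (`p0009.txt:L36–L37`) ·
  `B12.Bound025Printed` (used), `LocExpansion.ExpDecayBound` (def), `Step.SFHyp.bound118` (= (1.18), block 19),
  `B12LargeDomain.bound025_of_bound118` (proved: (1.18) IS (0.25) at a configuration in all the spaces).
* B12.Eq0.26 · the chain (0.26) and «Of course a bound of this type, with a divergence typical for a vacuum energy in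
  the four-dimensional space, should be expected, without use of cancellations» · pp. 257–258 [9–10] ·
  `B12.Chain026Printed` (end members, def), `B12.chain026_holds` ∕ `B12.chain026Printed_of` (proved from the
  displayed and SILENT inputs: tree-decay summability `hTree` — discharged in the model by
  `B12TreeDecay.hTree_of_volumeLeaf` —, cube count `hπ`, site count `hSites`), `B12.sum_le_sum_cubes`,
  `B12.scale_sum_le` (proved); delivered from `Hyp` by `Hyp.chain026` (§3).
* B12.Txt@258 («absent» row; the road map of p. 258, `p0010.txt:L5–L33`, printed text lines 4–31) · its clauses one by one: «𝐄^{(j)}(1) = 0»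
  — NO declaration stated it (the tree builds the subtraction 𝐄^{(j+1)}(g_j, U_k) − 𝐄^{(j+1)}(g_j, 1) of (1.3) p. 260
  into `Step.SFTower.Ek` ∕ `action13` ∕ `action16`) ⇒ TYPED here `VacuumNormalized258Printed` (§1) with
  `ek_eq_sum_of_vacuumNormalized`, `sum023_of_vacuumNormalized`, `ek_one_eq_zero`, `action16_one_eq_zero`; «The
  remaining terms sum up to a uniformly bounded expression» = (0.30) (below); (0.27) and «(5!/κ⁵)(Lʲη)⁵» — row
  B12.Eq0.27; «we introduce the local coordinates constructed in Sect. F [15] … U_k = exp iη𝐇 modulo a gauge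
  transformation» — `B11.SectFPrinted`, `B11.Prop8Printed`, `B11.Prop9Printed` ([15] Sect. F ∕ G, typed; cited only);
  «By the gauge invariance we have 𝐄^{(j)}(X, U_k) = 𝐄^{(j)}(X, exp iη𝐇)» — NO declaration ⇒ TYPED here
  `GaugeReduction258Printed` and PROVED from `Step.SFHyp` (`gaugeReduction258_of_sfHyp`, §1); «The fifth order term
  can be bounded by E₀O((Lʲη)⁵) exp(−κd_j(X))» — `B12Sect3Closing281.fifthOrder_bound_p258`,
  `B12Sect3Closing281.taylorRemainder_irrelevant_printed`, `B12CauchyRemainder354`, `B12Taylor334` (proved); «The sum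
  of lower order terms is analyzed with a help of Ward-Takahashi identities … yield an expansion of βA^η(exp iη𝐇)» —
  Sect. 4 rows (blocks 23–24: `B12Ward*`); «The remaining terms have bounds as above» —
  `B12Sect3Closing281.sect3_remaining_irrelevant` (proved); «We define the function β_j(g_{j−1}) to be equal to the
  coefficient β» — quoted in `B12.Sum028Printed`, the β-function of Sect. 5 (block 26, `Beta/*`).
* B12.Eq0.27 · (0.27) «and the first exponential can be bounded by an arbitrary positive power of Lʲη, e.g. by
  (5!/κ⁵)(Lʲη)⁵. This power is enough to control the sums in (0.23), (0.24)» · p. 258 [10] (`p0010.txt:L17–L22`) ·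
  `B12.Bound027Printed` (def; «large» abstract, DIVERGENCE F5), `B12.bound027_of_025`, `B12.exp_neg_inv_le_pow`,
  `B12.largeDomain_bound`, `B12.bound029_of_025_large`, `B12LargeDomain.bound029Large_of_bound118` (proved);
  delivered from `Hyp` by `Hyp.bound027`, `Hyp.bound029_large` (§3).
* B12.Eq0.28 · (0.28) · p. 258 [10] · `B12.Sum028Printed` (used in `Thm1ReadingPrinted`).
* B12.Eq0.29 · (0.29) «instead of (0.25)»; p. 259 «Terms satisfying the inequality (0.29) are called irrelevant» ·
  pp. 258–259 [10–11] · `B12.Bound029Printed` (used), `LocExpansion.IrrelevantBound` (def; the word «irrelevant»),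
  `B12LargeDomain.bound029Large_of_bound118` (proved).
* B12.Eq0.30 · «These inequalities yield a uniform bound of the sum (0.23) on the lattice T_η, i.e. the only
  dependence on k is through the volume |T_η| = |T₁^{(k)}| corresponding to the scale η. Indeed, we have» (0.30);
  p. 259 «For the effective action corresponding to the unit lattice, where k = K = log_L 1/ε, the above bound is
  uniform in the lattice spacing ε. This is the essence of the ultraviolet stability concept» · pp. 258–259 [10–11] ·
  `B12.Chain030Printed` (def), `B12.UVStable030` (def, the family version = «uniform in ε»), `UVStableBound` (one
  approximation), `B12.chain030_holds`, `B12.chain030Printed_of`, `B12.uvStable030_of_repr`, `B12.uvStable030_of_thm1`,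
  `B12TreeDecay.uvStable030_of_thm1_of_volumeLeaf` (proved); delivered from `Hyp` by `Hyp.uvStable030`,
  `Hyp.uvStable030_of_volumeLeaf` (§3).
* B12.Def@259 · Definition p. 259 «For the k-th action such a domain is determined by the condition |∂U_k(V) − 1| <
  ε₀η² on T_η, for ε₀ sufficiently small. Another possible definition, technically less convenient, is given by the
  condition |∂V − 1| < ε₀ on T₁^{(k)}» · p. 259 [11] (`p0011.txt:L16–L20`) · `B12SmallFieldDomain259.smallFieldDom`,
  `smallFieldDomAlt`, `mem_smallFieldDom`, `smallFieldDom_mono` (defs ∕ proved); the ABSTRACT domain of the family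
  level is the field `B12.RunData.dom` used below (cited; the identification is the model's).
* B12.Thm1 · Theorem 1 · p. 259 [11] (`p0011.txt:L21–L23`) · `B12.Thm1Printed` (used; its conclusion `B12.RunData.Repr`
  is abstract — the printed wording «given by the formulas (0.22)–(0.24), with terms satisfying (0.29)» is TYPED here
  as the reading `Thm1ReadingPrinted`, §2, exactly the hypotheses `h023` ∕ `h028` ∕ `h029` of `B12.uvStable030_of_repr`
  plus (0.22), (0.24) by name); `B12.thm1_of_thm3_fixedConsts`, `B12.thm1_of_thm3_twoStage` (proved bookkeeping: p. 259
  «The above theorem will be reformulated more elaborately in the next section» = Theorem 3, block 19,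
  `B12.Thm3Printed`).  p. 259 «It is interesting to notice that we do not assume any special asymptotic behavior of
  the coupling constants, like asymptotic freedom» = the hypothesis of `B12.Thm1Printed` is `Flow.InInterval` alone.
* B12.Txt@259 · «It will be proved in this paper for an arbitrary semisimple compact Lie group G ⊂ U(N), and for
  d = 4. The proof also covers the dimension d = 3 … g_k² = g²Lᵏε; hence the assumption of the above theorem is
  satisfied for g sufficiently small» · p. 259 [11] (`p0011.txt:L29–L36`) · `B12.interval_automatic_d3` (proved);
  scope sentences quoted in the module text of `…Balaban1983to89.B12`.
* B12.Thm2 · Theorem 2 with (0.31), «A proof of this theorem, based on perturbative calculations, will be given in a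
  separate paper, where more precise asymptotic behavior will be proved. The restriction to the group SU(2) is
  superficial and is done only to simplify calculations» · pp. 259–260 [11–12] (`p0011.txt:L37–L45`,
  `p0012.txt:L2–L3`) · `B12.Thm2Printed` (used; STATED WITHOUT PROOF IN PRINT — claim under adjudication,
  [Balaban1989LargeFieldII] p. 355 «has not been published yet»), `Missing.B12Thm2Shape`, `B16.Thm2Shape`
  (= `B12.Thm2Printed C.toB12 L`), `Step.Ineq031`, `Step.Discrete031`, `Step.Ineq031_iff_discrete031`,
  `Flow.LogRunning`, `Step.couplingTrajectory_exists` ∕ `Step.flow_exists_of_betaBounds` (proved real-sequence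
  content), `Dag.Thm2OfBeta`, `DagBinding.Thm2RegimeOf`, `DagBinding.EndpointExistence` (= the first half of the
  conjunct, the TARGET shape of K2⁷) with `DagBinding.thm2Printed_of_endpointExistence`; the function notation
  «g₀ = g₀(ε, g)» is `T4BareCouplingChart` and `T4Apex.YM4TorusContinuumPrintedSU'` (desk stems, cited only).
* B12.Eq0.32 · «all results of this paper are valid for a certain class of two-dimensional nonlinear σ-models, the
  so-called nonlinear chiral models … the action is given by» (0.32) «therefore we will discuss them separately in
  the future» · p. 260 [12] (`p0012.txt:L4–L11`) · `B12ChiralAction032.ChiralField`, `chiralBond`, `chiralAction`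
  (defs), `chiralAction_nonneg`, `chiralAction_const` (proved).  The VALIDITY claim for the chiral models is a
  by-reference announcement without printed proof («In fact all the results were obtained at first for this class
  of models … we will discuss them separately in the future»; `…Balaban1983to89.B12` § «Promised continuations») and
  is NOT typed (a hypothesis `def` of it would quantify over an untyped «all results of this paper»).
* B12.Def§1 · the inductive assumptions (1.1)–(1.19) · pp. 260–263 · `Step.SFTower`, `Step.SFHyp` (block 19; used
  here only as the CARRIER of §1 and the hypothesis of `gaugeReduction258_of_sfHyp`).
The further statement-level declarations with a locator in pp. 257–260 listed by `carve/CARVE-LIST.md` § Block 18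
are all cited above (`B12.Thm1Printed`, `B12.Thm2Printed`, `B12.Sum024Printed`, `B12.Bound025Printed`,
`B12.Chain026Printed`, `B12.Bound027Printed`, `B12.Sum028Printed`, `B12.Bound029Printed`, `B12.Chain030Printed`,
`B16.Thm2Shape`, `Dag.Thm2OfBeta`, `DagBinding.Thm2RegimeOf`, `Step.Ineq031`, `T4Apex.YM4TorusContinuumPrintedSU'`).

HONEST SCOPE.  (a) `VacuumNormalized258Printed` and `GaugeReduction258Printed` are hypothesis schemas over the
abstract tower `Step.SFTower` (configurations `Φ`, gauge action `act`, local agreement `agreeOn` are LETTERS of that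
carrier): the first is print's CONVENTION («we may assume»), not a theorem, and what is proved about it is
bookkeeping (the tree's subtraction becomes inert; (0.23) holds literally; 𝐄_k(1) = 0 and A_k(1) = 0 in the form
(1.6), matching the normalisation «𝐍_k is given by the integral above with V = 1» of (0.19), p. 256); the second is
proved from (1.7) + (1.19) as typed (`Step.SFHyp.localDep`, `gaugeInv119`) — the EXISTENCE of the chart 𝐇 on □̃
(Sect. F of [15]) is `B11.SectFPrinted` ∕ `B11.Prop8Printed` and is not touched.  (b) The bundle `Hyp` conjoins the
printed statements of pp. 257–260 at the family level; its conjunct `B12.Thm2Printed` is print's UNPROVED Theorem 2 —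
a node whose target is (a half of) Theorem 2 (K2⁷ `stmt-QuantumFields-20543`: `DagBinding.EndpointExistence`) must
treat that conjunct as its TARGET, never as an input (use `Hyp.assumed`, `Hyp.thm1`, `Hyp.reading`); the
redundancy Theorem 1 ∕ its reading ∕ (0.24) inside the assumption is print's own (Theorem 1 names (0.22)–(0.24)).
(c) The term data `Etot`, `EX`, `VX` (𝐄^{(j)}(U_k(V)), 𝐄^{(j)}(X, U_k(V)), 𝐕^{(j)}(X, U_k(V))) and the domain systems
`S P j` (𝐃_j of the run P) are letters named by the user, exactly as in `B12.uvStable030_of_repr`; one κ serves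
(0.25) and (0.29) as printed (a smaller rate in (0.29) is absorbed by monotonicity of (0.25) in κ).  (d) No
`instance`, no `notation`, 0 sorry; imports `…B12TreeDecay` (hence `…B12`, `Setup`) and `…Step` only.  NOT a node
discharge, NOT summit progress; nothing continuum, nothing about the mass gap.
-/

namespace Literature.MathematicalPhysics.QuantumFieldTheory.Balaban1983to89.B12Carve18Sect0ThmsHyp

open Literature.MathematicalPhysics.QuantumFieldTheory.Balaban1983to89

/-! ## §1 The two formal clauses of the p. 258 road map with no declaration in the tree (hypothesis form over the
§1 tower `Step.SFTower`), and their readings against the tree -/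

section Tower

variable {P : Params} {G : Type*} [GaugeGroup G] {Φ 𝒢 : Type*}

/-- **p. 258 [PDF 10], printed lines 4–8** (text layer `p0010.txt:L5–L9`), verbatim: «In fact there is one more
renormalization counterterm needed, it is a vacuum energy counterterm. It is contained in the normalization factors
in the integrals (0.17), (0.19), hence we may assume that it is included already in the definition of the function
𝐄^{(j)}, and 𝐄^{(j)}(1) = 0.»  TYPED over the small-field tower of the tree (`Step.SFTower`: `T.Etot j g φ` =
𝐄^{(j)}(g_{j−1}, φ) = Σ_{X∈𝐃_j} 𝐄^{(j)}(X, g_{j−1}, φ), (1.7); `T.ofBackground 1` = the pair (𝐔, 𝐉) of the unit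
background U_k = 1): the terms j + 1, j < k, of the k-th action — the indexing of `Step.SFTower.Ek` ∕ `action13`,
i.e. print's 𝐄^{(j)}, j = 1, …, k of (0.23) — VANISH at the unit configuration, each at its own coupling g_j.  A
CONVENTION of print («we may assume»), never asserted; the tree instead builds the subtraction
𝐄^{(j+1)}(g_j, U_k) − 𝐄^{(j+1)}(g_j, 1) printed in (1.3) p. 260 into `Step.SFTower.Ek`; under this convention that
subtraction is inert (`ek_eq_sum_of_vacuumNormalized`) and 𝐄_k is (0.23) as printed (`sum023_of_vacuumNormalized`). [cite: Balaban1987RG1, p.258 lines 4–8 (after (0.26)) + (0.23) p.256 + (1.3) p.260] -/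
def VacuumNormalized258Printed (T : Step.SFTower P G Φ 𝒢) (k : ℕ) : Prop :=
  ∀ j, j < k → T.Etot (j + 1) (T.flow.g j) (T.ofBackground 1) = 0

/-- **p. 258 [PDF 10], printed text lines 20–25, between (0.27) and (0.28)** (text layer `p0010.txt:L22–L27`),
verbatim: «If the localization domain is contained in a cube □̃, then we introduce the local coordinates constructed
in Sect. F [15] for the configurations U_k on □̃. This means that U_k = exp iη𝐇 modulo a gauge transformation, where 𝐇 is a regular, 𝐠-valued configuration
on □̃, and where the cube □̃ is considered as a subset of the η-lattice T_η. By the gauge invariance we have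
𝐄^{(j)}(X, U_k) = 𝐄^{(j)}(X, exp iη𝐇)».  TYPED (the last sentence) over the tree's tower `Step.SFTower` at the scales
j = 1, …, k: whenever a configuration φ (the pair of U_k) AGREES ON X with the gauge transform `T.act u ψ` of a
configuration ψ (the pair of exp iη𝐇) — the abstract local-agreement relation `T.agreeOn j X` of (1.7) and the
abstract gauge action `T.act` of (1.10), i.e. «U_k = exp iη𝐇 modulo a gauge transformation» on a set containing X —
the localized term takes the same value at φ and ψ, for every coupling g.  The existence of the chart 𝐇 (Sect. F of
[15]) is `B11.SectFPrinted` ∕ `B11.Prop8Printed` and is not part of this schema; the sentence FOLLOWS from the §1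
hypotheses (1.7) + (1.19) as typed in `Step.SFHyp` (`gaugeReduction258_of_sfHyp`). [cite: Balaban1987RG1, p.258 text lines 20–25 (between (0.27) and (0.28)) + (1.7) p.261 + (1.19) p.263] -/
def GaugeReduction258Printed (T : Step.SFTower P G Φ 𝒢) (k : ℕ) : Prop :=
  ∀ j, 1 ≤ j → j ≤ k → ∀ (X : (T.sys j).Dom) (g : ℝ) (u : 𝒢) (φ ψ : Φ),
    T.agreeOn j X φ (T.act u ψ) → T.E j X g φ = T.E j X g ψ

/-- **«By the gauge invariance we have 𝐄^{(j)}(X, U_k) = 𝐄^{(j)}(X, exp iη𝐇)» (p. 258) from the §1 hypotheses as typed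
in the tree**: local dependence (1.7) (`Step.SFHyp.localDep`: terms agreeing on X have equal 𝐄^{(j)}(X, ·)) and gauge
invariance (1.19) (`Step.SFHyp.gaugeInv119`) give `GaugeReduction258Printed` at every scale 1 ≤ j ≤ k.  Two rewrites;
the §1 clauses are block 19's and enter by name. [cite: Balaban1987RG1, p.258 text line 25 (before (0.28)) + (1.7) p.261 + (1.19) p.263] -/
theorem gaugeReduction258_of_sfHyp {T : Step.SFTower P G Φ 𝒢} {c : Step.SFConsts} {k : ℕ}
    (h : Step.SFHyp T c k) : GaugeReduction258Printed T k := by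
  intro j hj1 hjk X g u φ ψ hagree
  rw [h.localDep j hj1 hjk X g φ (T.act u ψ) hagree, h.gaugeInv119 j hj1 hjk X g u ψ]

/-- Re-indexing `Σ_{j=1}^{k} f(j) = Σ_{i=0}^{k−1} f(i+1)` (print's j = 1, …, k of (0.23) against the tower's
`Finset.range k` with terms `j + 1`).  Finite sums; private plumbing. [folklore] -/
private theorem sum_Icc_one_eq_sum_range {M : Type*} [AddCommMonoid M] (f : ℕ → M) (k : ℕ) :
    ∑ j ∈ Finset.Icc 1 k, f j = ∑ j ∈ Finset.range k, f (j + 1) := by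
  rw [Finset.range_eq_Ico, Finset.sum_Ico_add' f 0 k 1, zero_add, Finset.Ico_add_one_right_eq_Icc]

/-- Under the printed convention 𝐄^{(j)}(1) = 0 (p. 258) the subtraction built into the tree's `Step.SFTower.Ek` (the
bracket «[𝐄^{(j+1)}(g_j, U_k) − 𝐄^{(j+k)}(g_j, 1)]» of (1.3) p. 260) is inert:
`𝐄_k(U_k) = Σ_{j<k} [−β_{j+1}(g_j) A(U_k) + Re 𝐄^{(j+1)}(g_j, U_k)]` in the tower's indexing. [cite: Balaban1987RG1, p.258 lines 4–8 + (1.3) p.260] -/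
theorem ek_eq_sum_of_vacuumNormalized {T : Step.SFTower P G Φ 𝒢} {k : ℕ} (h : VacuumNormalized258Printed T k)
    (U : GaugeField P 0 G) :
    T.Ek k U = ∑ j ∈ Finset.range k,
      (-(T.flow.β (j + 1) (T.flow.g j)) * wilsonAction4 U
        + (T.Etot (j + 1) (T.flow.g j) (T.ofBackground U)).re) := by
  unfold Step.SFTower.Ek
  refine Finset.sum_congr rfl fun j hj => ?_
  rw [h j (Finset.mem_range.mp hj), Complex.zero_re, sub_zero]

/-- **(0.23) AS PRINTED for the tower's 𝐄_k under the convention of p. 258**: «𝐄_k(U_k) = Σ_{j=1}^{k} [−β_j(g_{j−1})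
A^η(U_k) + 𝐄^{(j)}(U_k)]» (`B12.Sum023Printed`, print's indexing j = 1, …, k with β_j(g_{j−1}) and 𝐄^{(j)}(g_{j−1}, ·))
holds for `Step.SFTower.Ek` — the (1.6)-form of the tree — as soon as 𝐄^{(j)}(1) = 0: the §0 display and the §1 form
(1.3)/(1.6) with its printed vacuum subtraction agree exactly under the §0 convention. [cite: Balaban1987RG1, (0.23) p.256 + p.258 lines 4–8 + (1.6) p.261] -/
theorem sum023_of_vacuumNormalized {T : Step.SFTower P G Φ 𝒢} {k : ℕ} (h : VacuumNormalized258Printed T k)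
    (U : GaugeField P 0 G) :
    B12.Sum023Printed (T.Ek k U) (wilsonAction4 U) (fun j => T.flow.β j (T.flow.g (j - 1)))
      (fun j => (T.Etot j (T.flow.g (j - 1)) (T.ofBackground U)).re) k := by
  simp only [B12.Sum023Printed]
  rw [ek_eq_sum_of_vacuumNormalized h U,
    sum_Icc_one_eq_sum_range
      (fun j => -(T.flow.β j (T.flow.g (j - 1))) * wilsonAction4 U
        + (T.Etot j (T.flow.g (j - 1)) (T.ofBackground U)).re) k]
  refine Finset.sum_congr rfl fun j _ => ?_
  simp only [Nat.add_sub_cancel]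

/-- The Wilson action (0.2) vanishes at the unit configuration («tr 1 = 1», p. 252) — elementary, re-derived inline
(the tree's `B10Eq2DensityTower.wilsonAction4_one` is the same fact for `fun _ => 1`; not imported; private plumbing). [cite: Balaban1987RG1, (0.2) p.252] -/
private theorem wilsonAction4_unit_eq_zero {j : ℕ} : wilsonAction4 (1 : GaugeField P j G) = 0 := by
  change wilsonAction4 (fun _ : PBond P j => (1 : G)) = 0
  unfold wilsonAction4 wilsonAction
  refine Finset.sum_eq_zero fun p _ => ?_
  simp [GaugeField.plaqHol, GaugeGroup.reTr_one]

/-- **𝐄_k(1) = 0 in the tree's (1.6)-form, unconditionally**: with the subtraction of (1.3) built in and A(1) = 0,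
the tower's 𝐄_k vanishes at the unit background — which is what the convention «𝐄^{(j)}(1) = 0» of p. 258 makes true
term by term for the sum (0.23). [cite: Balaban1987RG1, p.258 lines 4–8 + (1.3) p.260] -/
theorem ek_one_eq_zero (T : Step.SFTower P G Φ 𝒢) (k : ℕ) : T.Ek k 1 = 0 := by
  unfold Step.SFTower.Ek
  refine Finset.sum_eq_zero fun j _ => ?_
  rw [wilsonAction4_unit_eq_zero, sub_self, mul_zero, add_zero]

/-- **A_k(1) = 0 in the form (1.6) = (0.22)–(0.23)**: the k-th action of the tower vanishes at the unit background,
matching the normalisation of the renormalization transformation (0.19) — p. 256 [PDF 8] «where the constant 𝐍_k is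
given by the integral above with V = 1» (so that A_{k+1}(1) = 0; `Setup.SmallFieldStep`'s clause `A' 1 = 0`,
`B12Eq019ActionBody.nextAction_one`) — and the vacuum-energy sentence of p. 258.  Bookkeeping over
`Step.SFTower.action16_eq`. [cite: Balaban1987RG1, (0.19) pp.255–256 + (0.22) p.256 + p.258 lines 4–8] -/
theorem action16_one_eq_zero (T : Step.SFTower P G Φ 𝒢) (k : ℕ) : T.action16 k 1 = 0 := by
  rw [Step.SFTower.action16_eq, ek_one_eq_zero, wilsonAction4_unit_eq_zero, mul_zero, add_zero]

end Tower

/-! ## §2 The family-level readings and the bundle keyed to `stmt-QuantumFields-20543`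

Carriers, as in `…Balaban1983to89.B12` (`B12.uvStable030_of_repr`): `C : B12.Construction` = the family of lattice
approximations (run parameters `P = (K, m, g₀)` ↦ statement-level data `B12.RunData`: flow `g_k`, `β_k`; configurations
`Cfg k` on T₁^{(k)}; small-field domain `dom k` (Definition p. 259, abstract — the model's is
`B12SmallFieldDomain259.smallFieldDom`); `effAction k V` = A_k(g_k, V); `wilsonBG k V` = A^η(U_k(V)); `Ek k V` =
𝐄_k(U_k(V)); `numSites k` = |T₁^{(k)}|; `Repr k` = Theorem 1's conclusion at step k, abstract); `S P j` = 𝐃_j of the run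
P (a `LocDomainSys`, p. 257); `Etot P k V j` = 𝐄^{(j)}(U_k(V)); `EX P k V j X` = 𝐄^{(j)}(X, U_k(V)); `VX P k V j X` =
𝐕^{(j)}(X, U_k(V)); constants `E₀`, `κ` of (0.25), `O1` = the O(1) and `α` of (0.29), `L` = the block size as a real
(η = L^{−k} = (Lᵏ)⁻¹, (1.2)), as in `B12.Thm2Printed`. -/

section Family

/-- **p. 257 [PDF 9], printed lines 29–36** (text layer `p0009.txt:L30–L37`), verbatim: «We assume that the functions
𝐄^{(j)}(U), for regular gauge field configurations U, have the following representation  𝐄^{(j)}(U) = Σ_{X∈𝐃_j}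
𝐄^{(j)}(X, U),  (0.24)  where 𝐄^{(j)}(X, U) are analytic and gauge invariant functions of U, depending on U restricted
to X, and satisfying the inequality  |𝐄^{(j)}(X, U)| ≤ E₀ exp(−κd_j(X)),  (0.25)  with a sufficiently large constant
κ.»  TYPED at the family level, BY NAME through `B12.Sum024Printed` ((0.24)) and `B12.Bound025Printed` ((0.25)): along
every run P of the construction, at every step k ≤ K, at every configuration V of the small-field domain («for
regular gauge field configurations» — U = U_k(V)) and every scale j = 1, …, k of the sum (0.23), the values
𝐄^{(j)}(U_k(V)), 𝐄^{(j)}(X, U_k(V)) satisfy (0.24) and (0.25) with ONE pair of constants E₀, κ of the construction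
(«a sufficiently large constant κ» = the construction's choice, κ ≥ κ₀ in Theorem 3).  Analyticity ∕ gauge
invariance ∕ dependence on U restricted to X are the §1 clauses (`Step.SFHyp`, block 19; row B12.Eq0.24) and are not
part of this value-level schema.  An ASSUMPTION of print, never asserted; its §1 form is the inductive bound (1.18),
which IS (0.25) at the configurations of all the spaces (`B12LargeDomain.bound025_of_bound118`). [cite: Balaban1987RG1, (0.24)–(0.25) p.257] -/
def RepresentationAssumedPrinted (C : B12.Construction) (S : B12.RunParams → ℕ → LocDomainSys)
    (Etot : (P : B12.RunParams) → (k : ℕ) → (C P).Cfg k → ℕ → ℝ)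
    (EX : (P : B12.RunParams) → (k : ℕ) → (C P).Cfg k → (j : ℕ) → (S P j).Dom → ℝ)
    (E₀ κ : ℝ) : Prop :=
  ∀ (P : B12.RunParams) (k : ℕ), k ≤ P.K → ∀ V, V ∈ (C P).dom k → ∀ j ∈ Finset.Icc 1 k,
    B12.Sum024Printed (Etot P k V j) (EX P k V j) ∧ B12.Bound025Printed (EX P k V j) E₀ κ

/-- **Theorem 1, p. 259 [PDF 11] — the printed WORDING of its conclusion**, verbatim: «then the effective actions for
small fields are given by the formulas (0.22)–(0.24), with terms satisfying (0.29).»  The tree types Theorem 1 as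
`B12.Thm1Printed C` with an ABSTRACT conclusion `(C P).Repr k` («the effective action A_k is given by the formulas
(0.22)–(0.24), with terms satisfying (0.29)», docstring of `B12.RunData`); this schema is the READING of `Repr k` in
the printed words, BY NAME through the tree's displays: whenever `Repr k` holds along a run, (0.22) `B12.Repr022`
holds at step k, and at every V of the small-field domain (0.23) `B12.Sum023Printed` (𝐄_k = Σ_j [−β_j(g_{j−1})A^η +
𝐄^{(j)}]), and for every scale j = 1, …, k (0.24) `B12.Sum024Printed`, the extraction identity (0.28)
`B12.Sum028Printed` (−β_j(g_{j−1})A^η(U_k) + 𝐄^{(j)}(U_k) = Σ_X 𝐕^{(j)}(X, U_k), p. 258 «We define the function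
β_j(g_{j−1}) to be equal to the coefficient β. Thus we obtain») and the irrelevance bound (0.29)
`B12.Bound029Printed` with ONE O(1) =: `O1`, ONE α and κ for the whole family («uniform»: the placement of these
constants before the run, exactly as in `B12.uvStable030_of_repr`, whose hypotheses `h023`, `h028`, `h029` are the
last three members), η = L^{−k}.  A reading schema (the words of Theorem 1 over the tree's displays), never asserted. [cite: Balaban1987RG1, Thm 1 p.259 + (0.22)–(0.24) pp.256–257 + (0.28)–(0.29) p.258] -/
def Thm1ReadingPrinted (C : B12.Construction) (S : B12.RunParams → ℕ → LocDomainSys)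
    (Etot : (P : B12.RunParams) → (k : ℕ) → (C P).Cfg k → ℕ → ℝ)
    (EX VX : (P : B12.RunParams) → (k : ℕ) → (C P).Cfg k → (j : ℕ) → (S P j).Dom → ℝ)
    (O1 α κ L : ℝ) : Prop :=
  ∀ (P : B12.RunParams) (k : ℕ), (C P).Repr k →
    B12.Repr022 (C P) k ∧
    ∀ V, V ∈ (C P).dom k →
      B12.Sum023Printed ((C P).Ek k V) ((C P).wilsonBG k V)
          (fun j => (C P).flow.β j ((C P).flow.g (j - 1))) (Etot P k V) k ∧
      ∀ j ∈ Finset.Icc 1 k,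
        B12.Sum024Printed (Etot P k V j) (EX P k V j) ∧
        B12.Sum028Printed ((C P).flow.β j ((C P).flow.g (j - 1))) ((C P).wilsonBG k V)
          (Etot P k V j) (VX P k V j) ∧
        B12.Bound029Printed (VX P k V j) O1 L ((L ^ k)⁻¹) α κ j

/-- **BLOCK 18 OF [B12] (pp. 257–260) AS ONE HYPOTHESIS**, keyed to `stmt-QuantumFields-20543` (also feeds
`stmt-QuantumFields-20541`, `stmt-QuantumFields-20542`): the conjunction, BY NAME, of the section's printed statements
at the level of the family of lattice approximations — (1) the standing assumption (0.24)–(0.25) of p. 257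
`RepresentationAssumedPrinted`; (2) Theorem 1 (p. 259) `B12.Thm1Printed`; (3) the printed reading of Theorem 1's
conclusion through (0.22), (0.23), (0.24), (0.28), (0.29) `Thm1ReadingPrinted`; (4) Theorem 2 with (0.31) (pp. 259–260)
`B12.Thm2Printed` — STATED WITHOUT PROOF in print («A proof of this theorem, based on perturbative calculations, will be
given in a separate paper»), a claim under adjudication: a node whose target is (a half of) Theorem 2 — K2⁷
`stmt-QuantumFields-20543`, `DagBinding.EndpointExistence C` is the first half of conjunct (4) verbatim — takes (1)–(3)
(`Hyp.assumed`, `Hyp.thm1`, `Hyp.reading`) and must NOT feed itself conjunct (4).  A node prover takes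
`(h : Hyp …)`; the DERIVED displays of the section — (0.26), (0.27), (0.30) and the large-domain case of (0.29) — are
PROVED in the tree from these conjuncts plus the printed chains' silent inputs and are delivered in §3, not
hypothesised; the Definition of p. 259 (small-field domains) is the abstract `dom` of the carrier, (0.32) and the
geometry of p. 257 are definitions with bodies (INDEX in the module docstring).  `L` = the block size as a real (the
same letter in (0.29)'s Lʲη and in (0.31)'s log(Lᵏε)⁻¹ = (K − k) log L). [cite: Balaban1987RG1, (0.24)–(0.25) p.257 + Thm 1 p.259 + (0.28)–(0.29) p.258 + Thm 2 (0.31) pp.259–260] -/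
def Hyp (C : B12.Construction) (S : B12.RunParams → ℕ → LocDomainSys)
    (Etot : (P : B12.RunParams) → (k : ℕ) → (C P).Cfg k → ℕ → ℝ)
    (EX VX : (P : B12.RunParams) → (k : ℕ) → (C P).Cfg k → (j : ℕ) → (S P j).Dom → ℝ)
    (E₀ κ O1 α L : ℝ) : Prop :=
  RepresentationAssumedPrinted C S Etot EX E₀ κ ∧
  B12.Thm1Printed C ∧
  Thm1ReadingPrinted C S Etot EX VX O1 α κ L ∧
  B12.Thm2Printed C L

end Family

/-! ## §3 How the bundle delivers the section's derived displays (the theorems are the tree's; kernel-checked wiring)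

With `h : Hyp C S Etot EX VX E₀ κ O1 α L` and its conjuncts numbered (1)–(4) as in the docstring of `Hyp`:
* (0.26) p. 257 («Let us study implications of the inequality (0.25). We obtain …»): (1) + the silent inputs of the
  printed chain (tree-decay summability `hTree`, cube count `hπ`, site count `hSites`, `E₀ ≥ 0`, `L⁴ ≥ 2`, `M > 0`) ⇒
  `B12.Chain026Printed` at every run ∕ step ∕ small-field configuration — `Hyp.chain026` over `B12.chain026Printed_of`;
* (0.27) p. 258: (1) ⇒ `B12.Bound027Printed` on the domains with d_j(X) ≥ 2(Lʲη)⁻¹ — `Hyp.bound027` over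
  `B12.bound027_of_025`; and the «arbitrary positive power» form = (0.29) on the large domains — `Hyp.bound029_large`
  over `B12.bound029_of_025_large`;
* (0.30) pp. 258–259 («These inequalities yield a uniform bound … uniform in the lattice spacing ε. This is the essence
  of the ultraviolet stability concept»): (2) + (3) + the silent inputs ⇒ `∃ γ > 0, B12.UVStable030 C γ (O1·K₀·(1 −
  L^{−α})⁻¹) M` — `Hyp.uvStable030` over `B12.uvStable030_of_thm1`; with the tree-decay input DISCHARGED by the
  lattice-animal bound of the tree (`B12TreeDecay`: connected cube families of bounded degree + the quoted volume leaf,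
  κ ≥ κ₀(c₀, Δ)) — `Hyp.uvStable030_of_volumeLeaf` over `B12TreeDecay.uvStable030_of_thm1_of_volumeLeaf`. -/

section Delivery

variable {C : B12.Construction} {S : B12.RunParams → ℕ → LocDomainSys}
  {Etot : (P : B12.RunParams) → (k : ℕ) → (C P).Cfg k → ℕ → ℝ}
  {EX VX : (P : B12.RunParams) → (k : ℕ) → (C P).Cfg k → (j : ℕ) → (S P j).Dom → ℝ}
  {E₀ κ O1 α L : ℝ}

/-- The bundle IS the four-fold conjunction (1)–(4) of its docstring, definitionally (the printed statements of
pp. 257–260 by name; unfolding lemma, no content beyond `Hyp`). [cite: Balaban1987RG1, (0.24)–(0.25) p.257 + Thm 1 p.259 + Thm 2 (0.31) pp.259–260] -/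
theorem hyp_iff :
    Hyp C S Etot EX VX E₀ κ O1 α L ↔
      RepresentationAssumedPrinted C S Etot EX E₀ κ ∧ B12.Thm1Printed C ∧
        Thm1ReadingPrinted C S Etot EX VX O1 α κ L ∧ B12.Thm2Printed C L :=
  Iff.rfl

/-- Conjunct (1): the standing assumption (0.24)–(0.25) of p. 257, `RepresentationAssumedPrinted`. [cite: Balaban1987RG1, (0.24)–(0.25) p.257] -/
theorem Hyp.assumed (h : Hyp C S Etot EX VX E₀ κ O1 α L) : RepresentationAssumedPrinted C S Etot EX E₀ κ :=
  h.1

/-- Conjunct (2): Theorem 1 (p. 259), `B12.Thm1Printed`. [cite: Balaban1987RG1, Thm 1 p.259] -/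
theorem Hyp.thm1 (h : Hyp C S Etot EX VX E₀ κ O1 α L) : B12.Thm1Printed C :=
  h.2.1

/-- Conjunct (3): the printed reading of Theorem 1's conclusion, `Thm1ReadingPrinted`. [cite: Balaban1987RG1, Thm 1 p.259 + (0.22)–(0.24), (0.28)–(0.29) pp.256–258] -/
theorem Hyp.reading (h : Hyp C S Etot EX VX E₀ κ O1 α L) : Thm1ReadingPrinted C S Etot EX VX O1 α κ L :=
  h.2.2.1

/-- Conjunct (4): Theorem 2 with (0.31) (pp. 259–260), `B12.Thm2Printed` — print's UNPROVED claim; for K2⁷ this is the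
target shape, not an input. [cite: Balaban1987RG1, Thm 2 (0.31) pp.259–260] -/
theorem Hyp.thm2 (h : Hyp C S Etot EX VX E₀ κ O1 α L) : B12.Thm2Printed C L :=
  h.2.2.2

/-- From the reading (3): (0.22) at every step at which Theorem 1's conclusion holds. [cite: Balaban1987RG1, (0.22) p.256 + Thm 1 p.259] -/
theorem Hyp.repr022 (h : Hyp C S Etot EX VX E₀ κ O1 α L) (P : B12.RunParams) {k : ℕ} (hR : (C P).Repr k) :
    B12.Repr022 (C P) k :=
  (h.reading P k hR).1

/-- From Theorem 1 (2) and its reading (3): along every run with 0 < g_k ≤ γ (Theorem 1's γ), (0.22) holds at every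
step k ≤ K. [cite: Balaban1987RG1, Thm 1 p.259 + (0.22) p.256] -/
theorem Hyp.repr022_of_inInterval (h : Hyp C S Etot EX VX E₀ κ O1 α L) :
    ∃ γ : ℝ, 0 < γ ∧ ∀ P : B12.RunParams, (C P).flow.InInterval γ P.K → ∀ k, k ≤ P.K → B12.Repr022 (C P) k := by
  obtain ⟨γ, hγ, hRepr⟩ := h.thm1
  exact ⟨γ, hγ, fun P hP k hk => h.repr022 P (hRepr P hP k hk)⟩

/-- **(0.26) p. 257 over the bundle** («Let us study implications of the inequality (0.25). We obtain …  ≤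
E₀O(1)M⁻⁴|T₁^{(k)}|η⁻⁴, η = L⁻ᵏ»): conjunct (1) and the printed chain's silent inputs — tree-decay summability
`Σ_{X∈𝐃_j, X⊃□} exp(−κd_j(X)) ≤ K₀` for the cubes π_j (a `B12.CubeCover` per run and scale; discharged in the model by
`B12TreeDecay.hTree_of_volumeLeaf`), `|π_j| = M⁻⁴|T₁^{(j)}|`, `|T₁^{(j)}| = L^{4(k−j)}|T₁^{(k)}|` (d = 4), `E₀ ≥ 0`,
`L⁴ ≥ 2`, `M > 0` — give (0.26) as printed, `B12.Chain026Printed`, with O(1) = K₀, at every run, every step k ≤ K and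
every configuration of the small-field domain.  The tree's `B12.chain026Printed_of` after inserting (0.24). [cite: Balaban1987RG1, (0.26) p.257] -/
theorem Hyp.chain026 (h : Hyp C S Etot EX VX E₀ κ O1 α L) {M K₀ : ℝ} (hE₀ : 0 ≤ E₀) (hK₀ : 0 ≤ K₀)
    (hM : 0 < M) (hL4 : 2 ≤ L ^ 4)
    (π : (P : B12.RunParams) → (j : ℕ) → B12.CubeCover (S P j))
    (hTree : ∀ P j (c : (π P j).Cube), ∑ X ∈ (π P j).above c, Real.exp (-κ * (S P j).dj X) ≤ K₀)
    (hπ : ∀ P j, (Fintype.card (π P j).Cube : ℝ) = M⁻¹ ^ 4 * ((C P).numSites j : ℝ))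
    (hSites : ∀ P j k, j ≤ k → k ≤ P.K →
      ((C P).numSites j : ℝ) = (L ^ (k - j)) ^ 4 * ((C P).numSites k : ℝ))
    (P : B12.RunParams) {k : ℕ} (hk : k ≤ P.K) {V : (C P).Cfg k} (hV : V ∈ (C P).dom k) :
    B12.Chain026Printed (Etot P k V) E₀ K₀ M L ((C P).numSites k) k := by
  have hA := h.assumed P k hk V hV
  have key := B12.chain026Printed_of k (S P) (π P) (fun j X => EX P k V j X) E₀ κ K₀ M L
    (fun j => ((C P).numSites j : ℝ)) hE₀ hK₀ hM hL4 (Nat.cast_nonneg _)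
    (fun j hj => (hA j hj).2) (fun j _ c => hTree P j c) (fun j _ => hπ P j)
    (fun j hj => hSites P j k (Finset.mem_Icc.mp hj).2 hk)
  have hsum : ∑ j ∈ Finset.Icc 1 k, Etot P k V j = ∑ j ∈ Finset.Icc 1 k, ∑ X, EX P k V j X :=
    Finset.sum_congr rfl fun j hj => (hA j hj).1
  unfold B12.Chain026Printed at key ⊢
  rw [hsum]
  exact key

/-- **(0.27) p. 258 over the bundle** («If its localization domain X is large … then the inequality (0.25) ensures that
|𝐄^{(j)}(X, U_k)| ≤ E₀ exp(−κ(Lʲη)⁻¹) exp(−½κd_j(X))»): conjunct (1) gives `B12.Bound027Printed` for the terms of every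
run ∕ step ∕ scale on the domains X with d_j(X) ≥ 2(Lʲη)⁻¹ (the geometric criterion «not contained in any cube □̃,
with □ ∈ π_k» stays the abstract predicate `large`, DIVERGENCE F5 ∕ D-pv03.1), for κ ≥ 0 and any η.  The tree's
`B12.bound027_of_025`. [cite: Balaban1987RG1, (0.27) p.258] -/
theorem Hyp.bound027 (h : Hyp C S Etot EX VX E₀ κ O1 α L) (hκ : 0 ≤ κ) (P : B12.RunParams) {k : ℕ}
    (hk : k ≤ P.K) {V : (C P).Cfg k} (hV : V ∈ (C P).dom k) {j : ℕ} (hj : j ∈ Finset.Icc 1 k)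
    (large : (S P j).Dom → Prop) (η : ℝ) (hlarge : ∀ X, large X → 2 * (L ^ j * η)⁻¹ ≤ (S P j).dj X) :
    B12.Bound027Printed large (EX P k V j) E₀ κ L η j :=
  B12.bound027_of_025 large (EX P k V j) E₀ κ L η j hκ (h.assumed P k hk V hV j hj).2 hlarge

/-- **«the first exponential can be bounded by an arbitrary positive power of Lʲη, e.g. by (5!/κ⁵)(Lʲη)⁵. This power
is enough to control the sums in (0.23), (0.24)» (p. 258) over the bundle**: conjunct (1) gives, for the family
X ↦ 𝐄^{(j)}(X, U_k(V)) restricted to the domains with d_j(X) ≥ (Lʲη)⁻¹ (zero elsewhere), the irrelevance bound (0.29)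
`B12.Bound029Printed` with exponent 4 + α = N (every N; N = 5 is print's), constant E₀·N!/(δκ)ᴺ and rate (1 − δ)κ,
for κ > 0, δ > 0, Lʲη > 0.  The tree's `B12.bound029_of_025_large` (the «second, simpler case» of pp. 271–272). [cite: Balaban1987RG1, (0.27) p.258 + pp.271–272 + (0.29) p.258] -/
theorem Hyp.bound029_large (h : Hyp C S Etot EX VX E₀ κ O1 α L) (hκ : 0 < κ) (P : B12.RunParams) {k : ℕ}
    (hk : k ≤ P.K) {V : (C P).Cfg k} (hV : V ∈ (C P).dom k) {j : ℕ} (hj : j ∈ Finset.Icc 1 k)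
    (large : (S P j).Dom → Prop) [DecidablePred large] {δ η : ℝ} (hδ : 0 < δ) (hs : 0 < L ^ j * η) (N : ℕ)
    (hlarge : ∀ X, large X → (L ^ j * η)⁻¹ ≤ (S P j).dj X) :
    B12.Bound029Printed (fun X => if large X then EX P k V j X else 0)
      (E₀ * ((Nat.factorial N : ℝ) / (δ * κ) ^ N)) L η ((N : ℝ) - 4) ((1 - δ) * κ) j :=
  B12.bound029_of_025_large large (EX P k V j) E₀ κ δ L η j N (h.assumed P k hk V hV j hj).2 hκ hδ hs hlarge

/-- **(0.30) = ultraviolet stability over the bundle** (p. 258 «These inequalities yield a uniform bound of the sum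
(0.23) on the lattice T_η, i.e. the only dependence on k is through the volume |T_η| = |T₁^{(k)}|»; p. 259 «For the
effective action corresponding to the unit lattice, where k = K = log_L 1/ε, the above bound is uniform in the lattice
spacing ε. This is the essence of the ultraviolet stability concept»): Theorem 1 (2) with its printed reading (3) and
the printed chain's silent inputs (tree-decay summability ≤ K₀ for the cubes π_j, `|π_j| = M⁻⁴|T₁^{(j)}|`, `|T₁^{(j)}| =
L^{4(k−j)}|T₁^{(k)}|`; `O1 ≥ 0`, `α > 0`, `K₀ ≥ 0`, `M > 0`, `L > 1`) give `B12.UVStable030` — |𝐄_k(U_k(V))| ≤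
Cst·M⁻⁴·|T₁^{(k)}| with ONE constant Cst = O1·K₀·(1 − L^{−α})⁻¹ for every run of Theorem 1's interval ]0, γ], every
k ≤ K and every V of the small-field domain, hence uniform in ε = L⁻ᴷ.  The tree's `B12.uvStable030_of_thm1`, the
hypotheses `h023` ∕ `h028` ∕ `h029` being conjunct (3). [cite: Balaban1987RG1, (0.30) p.258 + p.259 lines 1–4] -/
theorem Hyp.uvStable030 (h : Hyp C S Etot EX VX E₀ κ O1 α L) (M K₀ : ℝ) (hO1 : 0 ≤ O1) (hα : 0 < α)
    (hK₀ : 0 ≤ K₀) (hM : 0 < M) (hL : 1 < L)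
    (π : (P : B12.RunParams) → (j : ℕ) → B12.CubeCover (S P j))
    (hTree : ∀ P j (c : (π P j).Cube), ∑ X ∈ (π P j).above c, Real.exp (-κ * (S P j).dj X) ≤ K₀)
    (hπ : ∀ P j, (Fintype.card (π P j).Cube : ℝ) = M⁻¹ ^ 4 * ((C P).numSites j : ℝ))
    (hSites : ∀ P j k, j ≤ k → k ≤ P.K →
      ((C P).numSites j : ℝ) = (L ^ (k - j)) ^ 4 * ((C P).numSites k : ℝ)) :
    ∃ γ : ℝ, 0 < γ ∧ B12.UVStable030 C γ (O1 * K₀ * (1 - L ^ (-α))⁻¹) M :=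
  B12.uvStable030_of_thm1 C O1 α κ K₀ M L hO1 hα hK₀ hM hL S π Etot VX h.thm1
    (fun P k hR V hV => ((h.reading P k hR).2 V hV).1)
    (fun P k hR V hV j hj => (((h.reading P k hR).2 V hV).2 j hj).2.1)
    (fun P k hR V hV j hj => (((h.reading P k hR).2 V hV).2 j hj).2.2)
    hTree hπ hSites

/-- **(0.30) over the bundle with the tree-decay input DISCHARGED** by the tree's lattice-animal bound
(`…Balaban1983to89.B12TreeDecay`): if the localization domains of every scale of every run ARE connected families of
cubes of π_j (a `B12TreeDecay.CubeSystem`, p. 257 «a union of a connected, finite family of cubes»), every cube has at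
most Δ wall-neighbours, the quoted volume leaf |X|_M ≤ c₀(1 + d_j(X)) holds, and κ ≥ κ₀(c₀, Δ), then Theorem 1 (2) with
its reading (3) and the two counts give `B12.UVStable030` with the constant O1·K₀(c₀, Δ)·(1 − L^{−α})⁻¹.  The tree's
`B12TreeDecay.uvStable030_of_thm1_of_volumeLeaf`. [cite: Balaban1987RG1, (0.30) p.258 + p.259 lines 1–4 + §0 p.257] -/
theorem Hyp.uvStable030_of_volumeLeaf (h : Hyp C S Etot EX VX E₀ κ O1 α L) (M c₀ : ℝ) (Δ : ℕ)
    (hO1 : 0 ≤ O1) (hα : 0 < α) (hM : 0 < M) (hL : 1 < L) (hκ : B12TreeDecay.kappa₀ c₀ Δ ≤ κ)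
    (Gc : (P : B12.RunParams) → (j : ℕ) → B12TreeDecay.CubeSystem (S P j))
    (hΔ : ∀ P j, (Gc P j).DegreeLE Δ) (hV : ∀ P j, (Gc P j).VolumeLeaf c₀)
    (hπ : ∀ P j, (Fintype.card (Gc P j).Cube : ℝ) = M⁻¹ ^ 4 * ((C P).numSites j : ℝ))
    (hSites : ∀ P j k, j ≤ k → k ≤ P.K →
      ((C P).numSites j : ℝ) = (L ^ (k - j)) ^ 4 * ((C P).numSites k : ℝ)) :
    ∃ γ : ℝ, 0 < γ ∧ B12.UVStable030 C γ (O1 * B12TreeDecay.K₀ c₀ Δ * (1 - L ^ (-α))⁻¹) M :=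
  B12TreeDecay.uvStable030_of_thm1_of_volumeLeaf C O1 α κ M L c₀ Δ hO1 hα hM hL hκ S Gc hΔ hV Etot VX h.thm1
    (fun P k hR V hV => ((h.reading P k hR).2 V hV).1)
    (fun P k hR V hV j hj => (((h.reading P k hR).2 V hV).2 j hj).2.1)
    (fun P k hR V hV j hj => (((h.reading P k hR).2 V hV).2 j hj).2.2)
    hπ hSites

end Delivery

end Literature.MathematicalPhysics.QuantumFieldTheory.Balaban1983to89.B12Carve18Sect0ThmsHyp
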